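import Mathlib
import HarnessLib
import Summits.HubbardSuperconductivity.HubbardSuperconductivity.Theorems.KLProgrammeKLRegimeTwoVolumeTowerBaseTransfer
import Summits.HubbardSuperconductivity.HubbardSuperconductivity.Theorems.KLProgrammeKLRegimeTwoVolumeSectorBlockShift

/-!
# Route `KLProgramme` — crux K3, VL child `KLRegimeVolumeLimitV17F2` (stmt-HubbardSuperconductivity-20440), blueprint v5 M5 / W4 base data: THE BASE TRANSFER
# IS BLOCK COVARIANT (third conjunct of the base-transfer bundle `hdataT` of `…TowerBase` / `towerDataT_of_partsD`; seat hubbard-kl-k3c4-p1 g14; `--supports` 20440)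

The BASE of the nested two-volume induction (`…TowerBase.tower_base_keyedDefect_eventually_le`, `…TowerTruncOfParts.towerDataT_of_partsD`) reads, for the
base transfer `klBaseTransfer (b·L) M β μ K` (`…TowerBaseDefs`: `(ε • E(F_0[K])·S_N) ⊕ (klSrcPlainBlock·S_N)` from the doubled grid legs to `SrcLabel (bL) M 0`),
its BLOCK COVARIANCE under the canonical doubled block structures: shifting the block index of the row label (`klBlockEquivD L b M 0`) and of the column leg
(`klGridBlockEquivD L b M`) by the same `δ′` does not change the entry's norm.  Both blocks of the transfer are cross-grid overlap kernels `E(F)·S_N`, whose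
entries depend on the sites only through their difference (`sectorAnalysis_mul_hubbardGridSub_apply_eq_char`), and a common block shift translates both
sites by the same box-lattice vector `L·δ′`:

* §1 `gridOverlap_translate` — `(E(F)·S_N)((y₀, y⃗+z), ℓ′) (((t, q⃗+z), σ), c) = (E(F)·S_N)((y₀, y⃗), ℓ′) (((t, q⃗), σ), c)`; `klBaseTransfer_translate`;
* §2 the grid-leg block structure: `gridBlock_symm_fst`, `gridBlock_symm_site`, `gridBlock_symm_add_eq` (twins of `…SectorBlockShift` for `GridLeg (GridPoint · N)`),
  `klGridBlockEquivD_symm_apply`;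
* §3 **`klBaseTransfer_blockCovariant`** — the displayed conjunct, for every frame `K`, `β ≠ 0`, every `L, b, M`.

Proofs only; no definition. [cite: BenfattoGiulianiMastropietro2006, §2.7 (2.70)–(2.71a)]
-/

noncomputable section

namespace Summit.HubbardSuperconductivity.HubbardSuperconductivity.Theorems.TwoVolumeSource

set_option linter.dupNamespace false -- summit = problem name (single-conjunct summit), D-0017

open Finset Literature.MathematicalPhysics.QuantumLattice GrassmannAlgebra Literature.Probability.LatticeModels
open Summit.HubbardSuperconductivity.HubbardSuperconductivity.Theorems.TwoPointAssembly
open Summit.HubbardSuperconductivity.HubbardSuperconductivity.Theorems.KLRegimeSplit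
open Summit.HubbardSuperconductivity.HubbardSuperconductivity.Theorems.KLProgrammeLegKernels
open Summit.HubbardSuperconductivity.HubbardSuperconductivity.Theorems.EngineV8
open Summit.HubbardSuperconductivity.HubbardSuperconductivity.Theorems.TwoVolumeDefect

/-! ## §1 Translation invariance of the cross-grid overlap kernels and of the base transfer -/

section Translate

variable {V M N : ℕ} [NeZero V] [NeZero M]

/-- **The cross-grid overlap kernel `E(F)·S_{4M}` is translation invariant in space.** [cite: BenfattoGiulianiMastropietro2006, §2.7 (2.70)] -/
theorem gridOverlap_translate {β : ℝ} (hβ : β ≠ 0) (F : Fin N → FreqMomentum V M → ℂ) (y₀ : ImagTimeIdx M) (y q z : TorusSite 2 V)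
    (ℓ' : SectorLeg N) (t : Fin (2 * (2 * M))) (σ c : Fin 2) :
    (sectorAnalysisMatrix V M β F * hubbardGridSub V M β (2 * (2 * M))) ((y₀, y + z), ℓ') (((t, q + z), σ), c) =
      (sectorAnalysisMatrix V M β F * hubbardGridSub V M β (2 * (2 * M))) ((y₀, y), ℓ') (((t, q), σ), c) := by
  obtain ⟨⟨ω, σ'⟩, c'⟩ := ℓ'
  by_cases h : σ = σ' ∧ c = c'
  · obtain ⟨rfl, rfl⟩ := h
    rw [sectorAnalysis_mul_hubbardGridSub_apply_eq_char hβ F (y₀, y + z) ω σ c (t, q + z),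
      sectorAnalysis_mul_hubbardGridSub_apply_eq_char hβ F (y₀, y) ω σ c (t, q)]
    dsimp only
    rw [add_sub_add_right_eq_sub]
  · have h1 : ¬ (((((t, q + z), σ), c) : GridLeg (GridPoint V (2 * (2 * M)))).1.2 = (((y₀, y + z), ((ω, σ'), c')) : SpaceTimeIdx V M × SectorLeg N).2.1.2 ∧
        ((((t, q + z), σ), c) : GridLeg (GridPoint V (2 * (2 * M)))).2 = (((y₀, y + z), ((ω, σ'), c')) : SpaceTimeIdx V M × SectorLeg N).2.2) := h
    have h2 : ¬ (((((t, q), σ), c) : GridLeg (GridPoint V (2 * (2 * M)))).1.2 = (((y₀, y), ((ω, σ'), c')) : SpaceTimeIdx V M × SectorLeg N).2.1.2 ∧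
        ((((t, q), σ), c) : GridLeg (GridPoint V (2 * (2 * M)))).2 = (((y₀, y), ((ω, σ'), c')) : SpaceTimeIdx V M × SectorLeg N).2.2) := h
    rw [sectorAnalysis_mul_hubbardGridSub_apply, if_neg h1, sectorAnalysis_mul_hubbardGridSub_apply, if_neg h2]

/-- **The base transfer is translation invariant in space** (both blocks are cross-grid overlap kernels). [cite: BenfattoGiulianiMastropietro2006, §2.7 (2.71)] -/
theorem klBaseTransfer_translate {β : ℝ} (hβ : β ≠ 0) (μ : ℝ) (K : TrigPolyC4v) (y₀ : ImagTimeIdx M) (y q z : TorusSite 2 V)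
    (ℓ' : SectorLeg (sectorCount 0)) (s' : Fin 2) (t : Fin (klGridN M)) (σ c s : Fin 2) :
    klBaseTransfer V M β μ K (((y₀, y + z), ℓ'), s') (((((t, q + z), σ), c)), s) = klBaseTransfer V M β μ K (((y₀, y), ℓ'), s') (((((t, q), σ), c)), s) := by
  rw [klBaseTransfer_apply, klBaseTransfer_apply]
  dsimp only
  split_ifs with h00 h11
  · -- the alive block `ε • E(F_0[K]) · S_N`
    rw [Matrix.smul_mul, Matrix.smul_apply, Matrix.smul_apply, gridOverlap_translate hβ]
  · -- the plain source block
    rw [klSrcPlainBlock_mul_apply, klSrcPlainBlock_mul_apply]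
    dsimp only
    split_ifs with h0
    · rw [gridOverlap_translate hβ]
    · rfl
  · rfl

end Translate

/-! ## §2 The canonical block structure of the grid legs: shifting the block index shifts the site -/

section GridBlock

variable {b L Lf N : ℕ}

/-- Time, spin and charge of the inverse of a grid-leg block structure with the residue property. [folklore] -/
theorem gridBlock_symm_fst [NeZero Lf] [NeZero L] (e : GridLeg (GridPoint Lf N) ≃ (Fin 2 → Fin b) × GridLeg (GridPoint L N))
    (he2 : ∀ X', (e X').2 = (((X'.1.1.1, fun i => (((X'.1.1.2 i).val : ℕ) : ZMod L)), X'.1.2), X'.2)) (blk : Fin 2 → Fin b) (Y : GridLeg (GridPoint L N)) :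
    (e.symm (blk, Y)).1.1.1 = Y.1.1.1 ∧ (e.symm (blk, Y)).1.2 = Y.1.2 ∧ (e.symm (blk, Y)).2 = Y.2 := by
  have h := he2 (e.symm (blk, Y))
  rw [Equiv.apply_symm_apply] at h
  refine ⟨?_, ?_, ?_⟩
  · exact (congrArg (fun q : GridLeg (GridPoint L N) => q.1.1.1) h).symm
  · exact (congrArg (fun q : GridLeg (GridPoint L N) => q.1.2) h).symm
  · exact (congrArg (fun q : GridLeg (GridPoint L N) => q.2) h).symm

/-- **The site of the inverse**: `(e⁻¹(β, Y)).site = (L·β_i + (Y.site i).val)_i`. [folklore] -/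
theorem gridBlock_symm_site [NeZero Lf] [NeZero L] (e : GridLeg (GridPoint Lf N) ≃ (Fin 2 → Fin b) × GridLeg (GridPoint L N))
    (he1 : ∀ X' i, ((e X').1 i : ℕ) = (X'.1.1.2 i).val / L)
    (he2 : ∀ X', (e X').2 = (((X'.1.1.1, fun i => (((X'.1.1.2 i).val : ℕ) : ZMod L)), X'.1.2), X'.2)) (blk : Fin 2 → Fin b) (Y : GridLeg (GridPoint L N)) :
    (e.symm (blk, Y)).1.1.2 = fun i => ((L * (blk i : ℕ) + (Y.1.1.2 i).val : ℕ) : ZMod Lf) := by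
  set X' := e.symm (blk, Y) with hX'
  have hβ : ∀ i, (blk i : ℕ) = (X'.1.1.2 i).val / L := fun i => by rw [← he1 X' i, hX', Equiv.apply_symm_apply]
  have hres : ∀ i, (Y.1.1.2 i).val = (X'.1.1.2 i).val % L := fun i => by
    have h := he2 X'
    rw [hX', Equiv.apply_symm_apply] at h
    have hi := congrArg (fun q : GridLeg (GridPoint L N) => q.1.1.2 i) h
    dsimp only at hi
    rw [← hX'] at hi
    rw [hi, ZMod.val_natCast]
  funext i
  rw [hβ i, hres i, Nat.div_add_mod, ZMod.natCast_zmod_val]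

/-- **Shifting the block index shifts the site by the box-lattice vector** (grid legs; pair form). [folklore] -/
theorem gridBlock_symm_add_eq [NeZero Lf] [NeZero L] (hLf : Lf = b * L) (e : GridLeg (GridPoint Lf N) ≃ (Fin 2 → Fin b) × GridLeg (GridPoint L N))
    (he1 : ∀ X' i, ((e X').1 i : ℕ) = (X'.1.1.2 i).val / L)
    (he2 : ∀ X', (e X').2 = (((X'.1.1.1, fun i => (((X'.1.1.2 i).val : ℕ) : ZMod L)), X'.1.2), X'.2)) (blk δ : Fin 2 → Fin b) (Y : GridLeg (GridPoint L N)) :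
    e.symm (blk + δ, Y) = ((((e.symm (blk, Y)).1.1.1, (e.symm (blk, Y)).1.1.2 + fun i => ((L * (δ i : ℕ) : ℕ) : ZMod Lf)), (e.symm (blk, Y)).1.2),
      (e.symm (blk, Y)).2) := by
  obtain ⟨ht, hσ, hc⟩ := gridBlock_symm_fst e he2 (blk + δ) Y
  obtain ⟨ht', hσ', hc'⟩ := gridBlock_symm_fst e he2 blk Y
  have hsite : (e.symm (blk + δ, Y)).1.1.2 = (e.symm (blk, Y)).1.1.2 + fun i => ((L * (δ i : ℕ) : ℕ) : ZMod Lf) := by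
    rw [gridBlock_symm_site e he1 he2, gridBlock_symm_site e he1 he2]
    funext i
    simp only [Pi.add_apply, Nat.cast_add]
    rw [natCast_mul_fin_add hLf]
    ring
  refine Prod.ext (Prod.ext (Prod.ext ?_ hsite) ?_) ?_
  · rw [ht, ht']
  · rw [hσ, hσ']
  · rw [hc, hc']

/-- The inverse of the canonical doubled grid block structure. [folklore] -/
theorem klGridBlockEquivD_symm_apply {L b M : ℕ} [NeZero L] [NeZero (b * L)] (blk : Fin 2 → Fin b) (y : GridLeg (GridPoint L (klGridN M))) (s : Fin 2) :
    (klGridBlockEquivD L b M).symm (blk, (y, s)) = ((klGridBlockEquiv L b M).symm (blk, y), s) := by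
  apply (klGridBlockEquivD L b M).injective
  rw [Equiv.apply_symm_apply, klGridBlockEquivD_apply, Equiv.apply_symm_apply]

end GridBlock

/-! ## §3 Block covariance of the base transfer -/

/-- **THE BASE TRANSFER IS BLOCK COVARIANT** (third conjunct of the base-transfer bundle of `…TowerBase` / `towerDataT_of_partsD`): for every frame `K`,
`β ≠ 0`, every `L, b, M`. [cite: BenfattoGiulianiMastropietro2006, §2.7 (2.70)–(2.71a)] -/
theorem klBaseTransfer_blockCovariant {L b M : ℕ} [NeZero L] [NeZero (b * L)] [NeZero M] {β : ℝ} (hβ : β ≠ 0) (μ : ℝ) (K : TrigPolyC4v)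
    (δ' β' β₁ : Fin 2 → Fin b) (xbar : SrcLabel L M 0) (y : GridLeg (GridPoint L (klGridN M)) × Fin 2) :
    ‖klBaseTransfer (b * L) M β μ K ((klBlockEquivD L b M 0).symm (β' + δ', xbar)) ((klGridBlockEquivD L b M).symm (β₁ + δ', y))‖ =
      ‖klBaseTransfer (b * L) M β μ K ((klBlockEquivD L b M 0).symm (β', xbar)) ((klGridBlockEquivD L b M).symm (β₁, y))‖ := by
  obtain ⟨xb, s'⟩ := xbar
  obtain ⟨yg, s⟩ := y
  rw [klBlockEquivD_symm_apply, klBlockEquivD_symm_apply, klGridBlockEquivD_symm_apply, klGridBlockEquivD_symm_apply,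
    sectorBlock_symm_add_eq (rfl : b * L = b * L) (klBlockEquiv L b M (sectorCount 0)) (klBlockEquiv_val L b M _) (klBlockEquiv_snd L b M _) β' δ' xb,
    gridBlock_symm_add_eq (rfl : b * L = b * L) (klGridBlockEquiv L b M) (klGridBlockEquiv_val L b M) (klGridBlockEquiv_snd L b M) β₁ δ' yg]
  set X := (klBlockEquiv L b M (sectorCount 0)).symm (β', xb) with hX
  set Y := (klGridBlockEquiv L b M).symm (β₁, yg) with hY
  obtain ⟨⟨y₀, ys⟩, ℓ'⟩ := X
  obtain ⟨⟨⟨t, q⟩, σ⟩, c⟩ := Y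
  dsimp only
  rw [klBaseTransfer_translate hβ]

end Summit.HubbardSuperconductivity.HubbardSuperconductivity.Theorems.TwoVolumeSource

end
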